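import Summits.BirchSwinnertonDyer.BirchSwinnertonDyer.Theorems.SignedLowerHalvesKobayashiLowerHalfSemistableDefmuMuParity
import HarnessLib

/-!
# The prime-to-`p` part of `Pic(𝒪_{p^{n+1}})` lies in the image of `Δ`; `Δ = Pic(𝒪_p)` when `p ∤ h(𝒪_p)`, and then the
# layer-`0` witness of Pollack–Weston's `μ = 0` is the single number `Σ_{σ ∈ Pic(𝒪_p)} ⟨σ x_1, φ⟩ mod p`

Route-independent `Theorems` file (cell `b2b-bsdres`, seat `b2b-bsdres-x10b` = class owner X6/X7, gen 43); part 4 of the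
series «defmu / supersingular theta elements» serving crux 2 `KobayashiLowerHalfSemistable` (stmt-BirchSwinnertonDyer-19000,
line «defmu», μ-input `pollackWeston2011_thm_2_5_hasMuZeroLAc`).
HONEST FRAMING: prove what is provable now; shrink each hard class to its core with data; no claim beyond stated classes.
Nothing about any curve is asserted and NO summit statement is proved here; BSD is not proved by any of this.

Part 3 (`…DefmuMuParity.lean`) reduced `T.HasMuZeroLAc p φ` (PW Thm. 2.5 (i) for one tower) to unit coefficients of the two
Darmon–Iovita elements `L_0 ∈ ℤ_p[Pic(𝒪_p)/Δ]`, `L_1 ∈ ℤ_p[Pic(𝒪_{p²})/Δ]`. This file makes the layer-`0` half EXPLICIT: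

* §1–2 tower bookkeeping: `ker(Pic(𝒪_{p^{k+1+j}}) → Pic(𝒪_{p^{k+1}}))` is killed by `p^j` and the multi-step restrictions
  are onto (`K` imaginary quadratic; iterating part 2a / the tree's one-step results).
* §3 **`mem_torsionImage_of_coprime_orderOf`** — every class of `Pic(𝒪_{p^{n+1}})` of order prime to `p` lies in
  `torsionImage (n+1)` (Bézout: a lift `g'` with `(g'^e)^{p^j} = 1` is corrected to `g'^{b p^j}`, `ae + bp^j = 1`); hence
  **`torsionImage_eq_top_of_not_dvd_card`**: if `p ∤ #Pic(𝒪_{p^{n+1}})` (only possible at `n = 0`: `#Pic(𝒪_p) = h_K (p − (d_K/p))/u`,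
  i.e. essentially `p ∤ h_K`) then `torsionImage = ⊤` — the docstring remark of `torsionImage` ("it contains the prime-to-`p`
  part") made a theorem, and Darmon–Iovita's `G_0 = G̃_1/Δ = 1` in that case.
* §4 **layer `0`**: if `torsionImage K p 1 = ⊤` then `Pic(𝒪_p)/Δ` is a point, `L_0` is the number `Σ_{σ ∈ Pic(𝒪_p)} y_1(σ)`
  (`coeff_lAc_zero_eq_sum`), and the even-parity witness at layer `0` reads **`p ∤ Σ_{σ ∈ Pic(𝒪_p)} ⟨σ x_1, φ⟩`**
  (`exists_isUnit_coeff_lAc_zero_iff`) — the total `ψ_f`-mass of the Gross points of conductor `p` of the tower's genus; with an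
  odd-layer witness this gives `HasMuZeroLAc` (`hasMuZeroLAc_of_layerZero_sum`).

## References

* [DarmonIovita2008] H. Darmon, A. Iovita, J. Inst. Math. Jussieu 7 (2008), §2.2 (`G̃_∞ = Δ × G_∞`, `G_n := G̃_{n+1}/Δ ≃ ℤ/pⁿℤ`, `L_n`).
* [BertoliniDarmon2005] M. Bertolini, H. Darmon, Ann. of Math. 162 (2005), §1.2 (21) (`Δ` = torsion of `G̃_∞`).
* [PollackWeston2011] R. Pollack, T. Weston, Compos. Math. 147 (2011), §2.4 Thm. 2.5 (i).
* [Cox2013] D. A. Cox, *Primes of the form x² + ny²*, §7.D Thm. 7.24 (ring class numbers).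
-/

noncomputable section

open scoped BigOperators Matrix

-- D-0017: single-problem summit, the namespace repeats the problem name by design.
set_option linter.dupNamespace false

namespace Summit.BirchSwinnertonDyer.BirchSwinnertonDyer.Theorems.DefmuSupersingularTheta

open Literature.NumberTheory.EllipticCurves Literature.NumberTheory.EllipticCurves.QuadOrderTower
  Literature.NumberTheory.Automorphic NumberField

universe u

variable {K : Type u} [Field K] [NumberField K] (p : ℕ) [hp : Fact p.Prime]
  {Nplus Nminus : ℕ} {S : Brandt.XiSetup Nplus Nminus}

/-! ### §1 The kernels `ker(Pic(𝒪_{p^{k+1+j}}) → Pic(𝒪_{p^{k+1}}))` are killed by `p^j` -/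

/-- **`ker(Pic(𝒪_{p^M}) → Pic(𝒪_{p^{k+1}}))` is killed by `p^{M−k−1}`** (`M = k + 1 + j`; `K` imaginary quadratic): each
one-step kernel above level `1` is killed by `p` (part 2a, `pow_eq_one_of_picRes_eq_one`). [cite: Cox2013, §7.D Thm. 7.24]
[cite: DarmonIovita2008, §2.2] -/
theorem pow_pow_eq_one_of_picRes_eq_one_tower (hK : IsImaginaryQuadratic K) (j : ℕ) :
    ∀ (k M : ℕ) (hM : M = k + 1 + j) (x : ClassGroup (quadOrder K (p ^ M))),
      picRes K (pow_dvd_pow p (by omega : k + 1 ≤ M)) x = 1 → x ^ p ^ j = 1 := by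
  induction j with
  | zero =>
    intro k M hM x hx
    rw [Nat.add_zero] at hM
    subst hM
    rw [picRes_self] at hx
    rw [pow_zero, pow_one, hx]
  | succ j ih =>
    intro k M hM x hx
    rw [pow_succ', pow_mul]
    refine ih (k + 1) M (by omega) (x ^ p) ?_
    rw [map_pow]
    apply pow_eq_one_of_picRes_eq_one p hK k
    rw [picRes_picRes]
    exact hx

/-! ### §2 The multi-step restrictions are onto -/

/-- **`Pic(𝒪_{p^M}) → Pic(𝒪_{p^{k+1}})` is onto** (`M ≥ k + 1`; `K` quadratic): composite of the one-step surjections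
`QuadOrderTower.picRes_surjective`. [cite: Cox2013, §7.D Thm. 7.24] -/
theorem picRes_surjective_tower (hK : IsImaginaryQuadratic K) (j : ℕ) :
    ∀ (k M : ℕ) (hM : M = k + 1 + j), Function.Surjective (picRes K (pow_dvd_pow p (by omega : k + 1 ≤ M))) := by
  induction j with
  | zero =>
    intro k M hM g
    rw [Nat.add_zero] at hM
    subst hM
    exact ⟨g, picRes_self _ g⟩
  | succ j ih =>
    intro k M hM g
    have hd : p ^ (k + 2) = p ^ (k + 1) * p := pow_succ p (k + 1)
    obtain ⟨g₁, hg₁⟩ := picRes_surjective (K := K) hK.1 (dvd_pow_self p k.succ_ne_zero) hd g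
    obtain ⟨g₂, hg₂⟩ := ih (k + 1) M (by omega) g₁
    refine ⟨g₂, ?_⟩
    rw [← picRes_picRes (pow_dvd_pow p (k + 1).le_succ) (pow_dvd_pow p (by omega : k + 2 ≤ M)), hg₂]
    exact hg₁

/-! ### §3 The prime-to-`p` part of `Pic(𝒪_{p^{n+1}})` lies in `torsionImage` -/

/-- **Classes of order prime to `p` lie in the image of `Δ`**: if `g ∈ Pic(𝒪_{p^{k+1}})` has `(ord g, p) = 1`, then
`g ∈ torsionImage (k+1)` with exponent `e = ord g` — for a lift `g'` to layer `k + 1 + j`, `g'^e` lies in the kernel, so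
`(g'^e)^{p^j} = 1` (§1), and with `ae + bp^j = 1` the lift `g'^{bp^j}` has exponent `e` and still restricts to `g^{bp^j} = g`.
("it contains the prime-to-`p` part of `G_n`", docstring of `torsionImage`.) [cite: BertoliniDarmon2005, §1.2 (21)]
[cite: DarmonIovita2008, §2.2] -/
theorem mem_torsionImage_of_coprime_orderOf (hK : IsImaginaryQuadratic K) (k : ℕ)
    {g : ClassGroup (quadOrder K (p ^ (k + 1)))} (hcop : (orderOf g).Coprime p) :
    g ∈ torsionImage K p (k + 1) := by
  haveI : Finite (ClassGroup (quadOrder K (p ^ (k + 1)))) := finite_classGroup (K := K) _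
  refine ⟨orderOf g, orderOf_pos g, fun M hM => ?_⟩
  obtain ⟨j, rfl⟩ := Nat.exists_eq_add_of_le hM
  obtain ⟨g', hg'⟩ := picRes_surjective_tower p hK j k (k + 1 + j) rfl g
  -- `(g'^e)^{p^j} = 1`
  have hker : picRes K (pow_dvd_pow p (by omega : k + 1 ≤ k + 1 + j)) (g' ^ orderOf g) = 1 := by
    rw [map_pow, hg', pow_orderOf_eq_one]
  have hkill := pow_pow_eq_one_of_picRes_eq_one_tower p hK j k (k + 1 + j) rfl (g' ^ orderOf g) hker
  -- Bézout `a e + b p^j = 1`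
  obtain ⟨a, b, hab⟩ := Nat.isCoprime_iff_coprime.mpr (hcop.pow_right j)
  have hkill' : g' ^ (orderOf g * p ^ j) = 1 := by rw [pow_mul]; exact hkill
  refine ⟨g' ^ (b * (p ^ j : ℕ) : ℤ), ?_, ?_⟩
  · rw [← zpow_natCast, ← zpow_mul]
    have e2 : (b * ((p ^ j : ℕ) : ℤ)) * ((orderOf g : ℕ) : ℤ) = ((orderOf g * p ^ j : ℕ) : ℤ) * b := by
      push_cast; ring
    rw [e2, zpow_mul, zpow_natCast, hkill', one_zpow]
  · rw [map_zpow, hg']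
    have e1 : (b * (p ^ j : ℕ) : ℤ) = 1 - ((orderOf g : ℕ) : ℤ) * a := by linear_combination hab
    rw [e1, zpow_sub, zpow_one, zpow_mul, zpow_natCast, pow_orderOf_eq_one, one_zpow, inv_one, mul_one]

/-- **`Δ = Pic(𝒪_{p^{n+1}})` when `p ∤ #Pic(𝒪_{p^{n+1}})`** (only possible for `n = 0`, `#Pic(𝒪_p) = h_K (p − (d_K/p))/[𝒪_K^× : 𝒪_p^×]`,
i.e. `p ∤ h_K` up to the unit index): every order divides the group order, so is prime to `p`. Then Darmon–Iovita's
`G_0 = G̃_1/Δ` is trivial. [cite: DarmonIovita2008, §2.2] [cite: BertoliniDarmon2005, §1.2 (21)] -/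
theorem torsionImage_eq_top_of_not_dvd_card (hK : IsImaginaryQuadratic K) (k : ℕ)
    (hcard : ¬ p ∣ Nat.card (ClassGroup (quadOrder K (p ^ (k + 1))))) : torsionImage K p (k + 1) = ⊤ := by
  haveI : Finite (ClassGroup (quadOrder K (p ^ (k + 1)))) := finite_classGroup (K := K) _
  refine eq_top_iff.mpr fun g _ => mem_torsionImage_of_coprime_orderOf p hK k ?_
  exact Nat.Coprime.symm ((hp.out.coprime_iff_not_dvd.mpr hcard).coprime_dvd_right (orderOf_dvd_natCard g))

/-! ### §4 Layer `0` when `Δ = Pic(𝒪_p)`: `L_0` is a number -/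

omit [NumberField K] hp in
/-- If `torsionImage K p 1 = ⊤`, the layer group `Pic(𝒪_p)/Δ` is a point. [cite: DarmonIovita2008, §2.2] -/
theorem acLayerGroup_one_eq (htop : torsionImage K p 1 = ⊤) (q q' : AcLayerGroup K p 1) : q = q' := by
  obtain ⟨a, rfl⟩ := QuotientGroup.mk'_surjective (torsionImage K p 1) q
  obtain ⟨b, rfl⟩ := QuotientGroup.mk'_surjective (torsionImage K p 1) q'
  rw [QuotientGroup.mk'_apply, QuotientGroup.mk'_apply, QuotientGroup.eq, htop]
  exact Subgroup.mem_top _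

/-- **`L_0 = Σ_{σ ∈ Pic(𝒪_p)} y_1(σ)`** (as the coefficient of the unique class) when `Δ = Pic(𝒪_p)`: the Darmon–Iovita element of
layer `0` is the total `ψ_f`-mass of the Gross points of conductor `p` of the tower's genus. [cite: DarmonIovita2008, §2.2 (L_n)] -/
theorem coeff_lAc_zero_eq_sum (htop : torsionImage K p 1 = ⊤) (φ : Brandt.ClassSet S.O → ℤ) (T : GrossPointTower K S p)
    [Fintype (ClassGroup (quadOrder K (p ^ 1)))] (q : AcLayerGroup K p 1) :
    (T.lAc p φ 0).coeff q = ∑ σ : ClassGroup (quadOrder K (p ^ 1)), ((T.y p φ 1 σ : ℤ) : ℤ_[p]) := by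
  classical
  have hq : acProj K p 1 1 = q⁻¹ := acLayerGroup_one_eq p htop _ _
  rw [coeff_lAc_eq_sum_torsionImage p φ T 0 q 1 hq]
  have hfilt : Finset.univ.filter (· ∈ torsionImage K p (0 + 1)) = Finset.univ := by
    ext σ
    simp only [Finset.mem_filter, Finset.mem_univ, true_and, iff_true]
    change σ ∈ torsionImage K p 1
    rw [htop]
    exact Subgroup.mem_top σ
  rw [hfilt]
  exact Finset.sum_congr rfl fun σ _ => by rw [one_mul]

/-- `p ∣ n` in `ℤ_p` iff in `ℤ`. [folklore] -/
theorem natCast_dvd_intCast_iff (n : ℤ) : (p : ℤ_[p]) ∣ (n : ℤ_[p]) ↔ (p : ℤ) ∣ n := by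
  rw [← PadicInt.norm_lt_one_iff_dvd, PadicInt.norm_int_lt_one_iff_dvd]

/-- **The layer-`0` witness is `p ∤ Σ_{σ ∈ Pic(𝒪_p)} ⟨σ x_1, φ⟩`** (when `Δ = Pic(𝒪_p)`, e.g. `p ∤ #Pic(𝒪_p)`): the even-parity
half of the two-layer certificate of part 3 is ONE integer modulo `p`. [cite: PollackWeston2011, §2.4 Thm. 2.5 (i)]
[cite: DarmonIovita2008, §2.2 (L_n)] -/
theorem exists_isUnit_coeff_lAc_zero_iff (htop : torsionImage K p 1 = ⊤) (φ : Brandt.ClassSet S.O → ℤ)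
    (T : GrossPointTower K S p) [Fintype (ClassGroup (quadOrder K (p ^ 1)))] :
    (∃ q, IsUnit ((T.lAc p φ 0).coeff q)) ↔ ¬ (p : ℤ) ∣ ∑ σ : ClassGroup (quadOrder K (p ^ 1)), T.y p φ 1 σ := by
  classical
  constructor
  · rintro ⟨q, hq⟩
    rw [coeff_lAc_zero_eq_sum p htop φ T q, ← Int.cast_sum, isUnit_iff_not_dvd, natCast_dvd_intCast_iff] at hq
    exact hq
  · intro h
    refine ⟨acProj K p 1 1, ?_⟩
    rw [coeff_lAc_zero_eq_sum p htop φ T, ← Int.cast_sum, isUnit_iff_not_dvd, natCast_dvd_intCast_iff]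
    exact h

/-- **PW Thm. 2.5 (i) for one tower from `p ∤ Σ_{σ ∈ Pic(𝒪_p)} ⟨σ x_1, φ⟩` and one odd-layer witness**, when `Δ = Pic(𝒪_p)`
(`K` imaginary quadratic, `p` odd, `p ∤ N⁺N⁻`, `T(p)φ = aφ` with `p ∣ a`). [cite: PollackWeston2011, §2.4 Thm. 2.5 (i)]
[cite: DarmonIovita2008, §2.2 (8)] -/
theorem hasMuZeroLAc_of_layerZero_sum [Fintype (Brandt.ClassSet S.O)] (hK : IsImaginaryQuadratic K)
    (hp2 : p ≠ 2) (hpN : ¬ p ∣ Nplus * Nminus) (φ : Brandt.ClassSet S.O → ℤ) (a : ℤ)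
    (hφ : Brandt.matrix S.O p *ᵥ φ = a • φ) (hpa : (p : ℤ) ∣ a) (T : GrossPointTower K S p)
    (htop : torsionImage K p 1 = ⊤) [Fintype (ClassGroup (quadOrder K (p ^ 1)))]
    (h0 : ¬ (p : ℤ) ∣ ∑ σ : ClassGroup (quadOrder K (p ^ 1)), T.y p φ 1 σ)
    (h1 : ∃ q, IsUnit ((T.lAc p φ 1).coeff q)) : T.HasMuZeroLAc p φ :=
  hasMuZeroLAc_of_isUnit_coeff_zero_one p hK hp2 hpN φ a hφ hpa T
    ((exists_isUnit_coeff_lAc_zero_iff p htop φ T).mpr h0) h1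

/-- The same with the hypothesis `p ∤ #Pic(𝒪_p)` (so `Δ = Pic(𝒪_p)` by `torsionImage_eq_top_of_not_dvd_card`).
[cite: PollackWeston2011, §2.4 Thm. 2.5 (i)] [cite: DarmonIovita2008, §2.2] -/
theorem hasMuZeroLAc_of_layerZero_sum_of_not_dvd_card [Fintype (Brandt.ClassSet S.O)] (hK : IsImaginaryQuadratic K)
    (hp2 : p ≠ 2) (hpN : ¬ p ∣ Nplus * Nminus) (φ : Brandt.ClassSet S.O → ℤ) (a : ℤ)
    (hφ : Brandt.matrix S.O p *ᵥ φ = a • φ) (hpa : (p : ℤ) ∣ a) (T : GrossPointTower K S p)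
    [Fintype (ClassGroup (quadOrder K (p ^ 1)))]
    (hcard : ¬ p ∣ Nat.card (ClassGroup (quadOrder K (p ^ 1))))
    (h0 : ¬ (p : ℤ) ∣ ∑ σ : ClassGroup (quadOrder K (p ^ 1)), T.y p φ 1 σ)
    (h1 : ∃ q, IsUnit ((T.lAc p φ 1).coeff q)) : T.HasMuZeroLAc p φ :=
  hasMuZeroLAc_of_layerZero_sum p hK hp2 hpN φ a hφ hpa T (torsionImage_eq_top_of_not_dvd_card p hK 0 hcard) h0 h1

end Summit.BirchSwinnertonDyer.BirchSwinnertonDyer.Theorems.DefmuSupersingularTheta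

end
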